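import Summits.Ventures.HodgeRepro2.T5SU11GaussLegendre
import Summits.Ventures.HodgeRepro2.T5SU11LegendreDerivativeSum

/-!
# Where the zeros of `P_n` sit: `|r| ≤ 1 − 2/(n(n + 1))` for every zero, and the largest zero is `≥ 1/√3`

Two elementary localisations of the zeros of `P_n` (row 400):

* **`|r| ≤ 1 − 2/(n(n + 1))` for every zero `r` of `P_n`** (`abs_root_le`): by the mean value theorem on `[r, 1]`,
  `1 = P_n(1) − P_n(r) = (1 − r) P'_n(c)` with `P'_n(c) ≤ n(n + 1)/2` (Markov's bound, row 404), so
  `1 − r ≥ 2/(n(n + 1))`; the same at `−1` by parity;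
* **the largest zero is `≥ 1/√3` for `n ≥ 2`** (`exists_root_sq_ge`, `exists_root_ge`): Gauss–Legendre quadrature
  (row 408) on `f = X²` gives `Σ_i w_i x_i² = ∫_{−1}^{1} x² = 2/3` with `Σ_i w_i = 2`, `w_i > 0`, so some node has
  `x_i² ≥ 1/3`.

Nothing is claimed about (N).

Blind lane: Mathlib + the HodgeRepro2 prefix only; no sorry; axioms ⊆ {propext, Classical.choice,
Quot.sound}.
-/

namespace Summit.Ventures.HodgeRepro2.T5SU11LegendreZeroBounds

open Polynomial intervalIntegral Finset Set
open T5SU11SphericalLegendreAll T5SU11SphericalLegendreLaplace T5SU11LegendreIdentities T5SU11LegendreZeros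
  T5SU11LegendreDerivativeSum T5SU11GaussLegendre

/-! ### The zeros stay `2/(n(n+1))` away from `±1` -/

/-- **`r ≤ 1 − 2/(n(n + 1))` for every zero `r` of `P_n`**, `n ≥ 1` (mean value theorem + Markov's bound). -/
theorem root_le {n : ℕ} (hn : 1 ≤ n) {r : ℝ} (hr : legP n r = 0) : r ≤ 1 - 2 / ((n : ℝ) * (n + 1)) := by
  have hr1 : r < 1 := by
    rcases lt_or_ge r 1 with h | h
    · exact h
    · exfalso
      exact legP_ne_zero_of_one_le_abs n (by rw [abs_of_nonneg (by linarith)]; exact h) hr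
  have hrm : -1 < r := by
    rcases lt_or_ge (-1) r with h | h
    · exact h
    · exfalso
      exact legP_ne_zero_of_one_le_abs n (by rw [abs_of_nonpos (by linarith)]; linarith) hr
  -- the mean value theorem on `[r, 1]`
  obtain ⟨c, hc, hc'⟩ := exists_hasDerivAt_eq_slope (legP n) (legQ n) hr1 (continuous_legP n).continuousOn
    fun x _ => hasDerivAt_legP n x
  rw [legP_one, hr, sub_zero] at hc'
  have hcI : c ∈ Icc (-1 : ℝ) 1 := ⟨by linarith [hc.1], hc.2.le⟩
  have hM := abs_legQ_le n hcI
  have hQ : legQ n c ≤ (n : ℝ) * (n + 1) / 2 := (le_abs_self _).trans hM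
  have hpos : (0 : ℝ) < (n : ℝ) * (n + 1) := by
    have : (1 : ℝ) ≤ n := by exact_mod_cast hn
    positivity
  have h1r : 0 < 1 - r := by linarith
  -- `1/(1 − r) = P'_n(c) ≤ n(n+1)/2`
  have : 1 / (1 - r) ≤ (n : ℝ) * (n + 1) / 2 := by rw [← hc']; exact hQ
  rw [div_le_iff₀ h1r] at this
  have h2 : 2 / ((n : ℝ) * (n + 1)) ≤ 1 - r := by
    rw [div_le_iff₀ hpos]
    nlinarith
  linarith

/-- **`−1 + 2/(n(n + 1)) ≤ r` for every zero `r` of `P_n`**, `n ≥ 1` (parity). -/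
theorem le_root {n : ℕ} (hn : 1 ≤ n) {r : ℝ} (hr : legP n r = 0) : -1 + 2 / ((n : ℝ) * (n + 1)) ≤ r := by
  have h := root_le hn ((legP_neg_eq_zero_iff n r).mpr hr)
  linarith

/-- **`|r| ≤ 1 − 2/(n(n + 1))` for every zero `r` of `P_n`**, `n ≥ 1`. -/
theorem abs_root_le {n : ℕ} (hn : 1 ≤ n) {r : ℝ} (hr : legP n r = 0) : |r| ≤ 1 - 2 / ((n : ℝ) * (n + 1)) :=
  abs_le.mpr ⟨by linarith [le_root hn hr], root_le hn hr⟩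

/-! ### The largest zero is at least `1/√3` -/

/-- **Some zero of `P_n` has `r² ≥ 1/3`** for `n ≥ 2` (Gauss–Legendre on `X²`: `Σ w_i x_i² = 2/3`, `Σ w_i = 2`). -/
theorem exists_root_sq_ge {n : ℕ} (hn : 2 ≤ n) : ∃ r, legP n r = 0 ∧ 1 / 3 ≤ r ^ 2 := by
  obtain ⟨s, hcard, -, hs, hw, hsum, hrule⟩ := exists_gauss_legendre_rule (show 1 ≤ n by omega)
  have hint : ∫ x in (-1 : ℝ)..1, ((X : ℝ[X]) ^ 2).eval x = 2 / 3 := by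
    simp_rw [eval_pow, eval_X]
    rw [integral_pow]
    norm_num
  have h := hrule ((X : ℝ[X]) ^ 2) (by rw [natDegree_X_pow]; omega)
  rw [hint] at h
  simp_rw [eval_pow, eval_X] at h
  by_contra hcon
  push Not at hcon
  -- every node has `x_i² < 1/3`, so `Σ w_i x_i² < Σ w_i / 3 = 2/3`
  have hlt : ∑ i ∈ s, weight s i * i ^ 2 < ∑ i ∈ s, weight s i * (1 / 3) := by
    have hne : s.Nonempty := Finset.card_pos.mp (by omega)
    refine Finset.sum_lt_sum (fun i hi => mul_le_mul_of_nonneg_left (hcon i (hs i hi)).le (hw i hi).le)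
      ⟨hne.choose, hne.choose_spec, mul_lt_mul_of_pos_left (hcon _ (hs _ hne.choose_spec)) (hw _ hne.choose_spec)⟩
  rw [← Finset.sum_mul, hsum] at hlt
  linarith

/-- **The largest zero of `P_n` is `≥ 1/√3`** for `n ≥ 2`. -/
theorem exists_root_ge {n : ℕ} (hn : 2 ≤ n) : ∃ r, legP n r = 0 ∧ 1 / Real.sqrt 3 ≤ r := by
  obtain ⟨r, hr, hr2⟩ := exists_root_sq_ge hn
  -- by symmetry we may take `r ≥ 0`: replace `r` by `|r|`
  refine ⟨|r|, ?_, ?_⟩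
  · rcases le_or_gt 0 r with h | h
    · rwa [abs_of_nonneg h]
    · rw [abs_of_neg h]
      exact (legP_neg_eq_zero_iff n r).mpr hr
  · rw [div_le_iff₀ (by positivity), ← Real.sqrt_sq (abs_nonneg r), ← Real.sqrt_mul (by positivity), sq_abs]
    refine Real.one_le_sqrt.mpr ?_
    nlinarith

/-- **The zeros of `P_n` lie in `[−1 + 2/(n(n+1)), 1 − 2/(n(n+1))]`**, and for `n ≥ 2` the extreme ones have `|r| ≥ 1/√3`:
the packaged statement. -/
theorem root_bounds {n : ℕ} (hn : 2 ≤ n) :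
    (∀ r, legP n r = 0 → |r| ≤ 1 - 2 / ((n : ℝ) * (n + 1))) ∧ ∃ r, legP n r = 0 ∧ 1 / Real.sqrt 3 ≤ r :=
  ⟨fun _ hr => abs_root_le (by omega) hr, exists_root_ge hn⟩

end Summit.Ventures.HodgeRepro2.T5SU11LegendreZeroBounds
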